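import Literature.Barriers.Parity.FordMaynardPrimeSievesProofs

/-!
# `BalancedSemiprimeLayer` (crux stmt-Parity-9469): Type-I blindness of the layer — part 1,
# Ford–Maynard's Theorem 4.16 sequence with its support recorded

Negative-side structural lemmas (lead seat c19 of the line `smooth-modulus-twisted-hooley`,
prover-line-stmt-Parity-9469-c19-0), PROVED.  Obstruction O1 ("data-blindness") of the crux census
`Cruxes/BalancedSemiprimeLayer/STRATEGY-CENSUS.md` says that divisibility information on the values
below the balanced window cannot see the balanced-semiprime layer; the disprover's `Disproof.lean`
notes that no impossibility THEOREM for this is in the record.  This file and its sequel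
`TypeIBlindLayer.lean` supply one in the vocabulary of the tree's Ford–Maynard barrier catalogue
(`Literature.Barriers.Parity.FordMaynard.TypeI` = the Type-I bound (I) of K. Ford, J. Maynard,
*On the theory of prime producing sieves*, arXiv:2407.14368, §1) by reading one more property off the
tree's PROVED construction for their Theorem 4.16 (`FordMaynard.primeFreeAdmissible_of_window`,
`FordMaynardPrimeSievesProofs.lean`): the prime-free Type-I-admissible sequence `a` built there puts,
on the products `p·q` of two primes with least factor `p ∈ (x^{α₁}, x^{α₂}]`, a total mass at least
the number of primes of `(x/2, x]` (up to one block of length `≤ x/(4 (log x)^B)`).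

* `sum_seqA_filter_isPQ_blk`, `card_primes_le_sum_seqA_isPQ`, `card_primes_sub_le_sum_seqA_isPQ` —
  block bookkeeping: in every full block the almost-primes carry weight `#almost-primes + #primes`;
* `exists_typeI_primeFree_isPQHeavy` — Theorem 4.16's sequence (Type-I clause) with the extra
  conclusion "mass on the almost-primes `≥ #primes(x/2, x] − x/(4 (log x)^B)`".  (The Type-II clause
  of the tree's theorem could be carried along verbatim; it is irrelevant for the crux, whose values of
  one polynomial of degree `≥ 2` admit no Type-II range.)

References: K. Ford, J. Maynard, arXiv:2407.14368 (2024), Theorem 4.16 and its proof; tree file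
`Literature/Barriers/Parity/FordMaynardPrimeSievesProofs.lean`.  Everything used is PROVED in the tree.
-/

noncomputable section

open Filter Finset Real
open Literature.Barriers.Parity.FordMaynard

namespace Summit.Parity.BatemanHorn.Theorems.BalancedSemiprimeLayer.Negative

/-! ### Block bookkeeping: the mass the construction puts on its almost-primes -/

/-- In a full block `j < J` of a balanced block construction, the almost-primes (`IsPQ` numbers)
carry total weight `#almost-primes + #primes` of the block (each carries `1 + πⱼ/Nⱼ`). [folklore] -/
theorem sum_seqA_filter_isPQ_blk (D : BlockData) {C₁ : ℝ} (hB : D.Balanced C₁) {j : ℕ}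
    (hj : j < D.J) :
    ∑ n ∈ (D.blk j).filter (IsPQ D.P₁ D.P₂), D.seqA n = (D.pqCard j : ℝ) + D.primeCard j := by
  have key : ∀ n ∈ (D.blk j).filter (IsPQ D.P₁ D.P₂), D.seqA n = 1 + D.ratio j := by
    intro n hn
    rw [mem_filter] at hn
    have hw := D.w_eq_of_mem_blk hj hn.1
    rw [if_neg hn.2.not_prime, if_pos hn.2] at hw
    unfold BlockData.w at hw
    linarith
  rw [sum_congr rfl key, sum_const, nsmul_eq_mul]
  have h := D.ratio_mul_pqCard_eq hB hj
  unfold BlockData.pqCard at h ⊢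
  rw [mul_add, mul_one, mul_comm, h]

/-- The prefix version: for `t ≤ J`, the almost-primes of `(H, H + tL]` carry total weight at least
the number of primes of `(H, H + tL]`. [folklore] -/
theorem card_primes_le_sum_seqA_isPQ (D : BlockData) {C₁ : ℝ} (hB : D.Balanced C₁) {t : ℕ}
    (ht : t ≤ D.J) :
    (((Ioc D.H (D.H + t * D.L)).filter Nat.Prime).card : ℝ) ≤
      ∑ n ∈ (Ioc D.H (D.H + t * D.L)).filter (IsPQ D.P₁ D.P₂), D.seqA n := by
  induction t with
  | zero => simp
  | succ t ih =>
    have htJ : t < D.J := Nat.lt_of_succ_le ht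
    have h0 : D.H ≤ D.H + t * D.L := Nat.le_add_right _ _
    have h1 : D.H + t * D.L ≤ D.H + t * D.L + D.L := Nat.le_add_right _ _
    have hsplit : Ioc D.H (D.H + (t + 1) * D.L) = Ioc D.H (D.H + t * D.L) ∪ D.blk t := by
      rw [BlockData.blk, Nat.succ_mul, ← add_assoc]
      exact (Ioc_union_Ioc_eq_Ioc h0 h1).symm
    have hdisj : Disjoint (Ioc D.H (D.H + t * D.L)) (D.blk t) := by
      rw [BlockData.blk]
      exact Ioc_disjoint_Ioc_of_le le_rfl
    rw [hsplit, filter_union, filter_union, card_union_of_disjoint (disjoint_filter_filter hdisj),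
      sum_union (disjoint_filter_filter hdisj), Nat.cast_add]
    have ih' := ih htJ.le
    have hblk := sum_seqA_filter_isPQ_blk D hB htJ
    rw [hblk]
    have hpq : (0 : ℝ) ≤ D.pqCard t := Nat.cast_nonneg _
    have hpr : (((D.blk t).filter Nat.Prime).card : ℝ) = D.primeCard t := rfl
    rw [hpr]
    linarith

/-- Truncation at any `X ∈ [H, H + JL]`: the almost-primes of `(H, X]` carry total weight at least
`#primes(H, X] − L` (only the last, partial block is lost). [folklore] -/
theorem card_primes_sub_le_sum_seqA_isPQ (D : BlockData) {C₁ : ℝ} (hB : D.Balanced C₁) {X : ℕ}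
    (hHX : D.H ≤ X) (hX : X ≤ D.top) :
    (((Ioc D.H X).filter Nat.Prime).card : ℝ) - D.L ≤
      ∑ n ∈ (Ioc D.H X).filter (IsPQ D.P₁ D.P₂), D.seqA n := by
  have hL := D.L_pos
  have htop : D.top = D.H + D.J * D.L := rfl
  obtain ⟨R, rfl⟩ : ∃ R, X = D.H + R := ⟨X - D.H, (Nat.add_sub_cancel' hHX).symm⟩
  set t : ℕ := R / D.L with ht
  have hdiv : D.L * t + R % D.L = R := by rw [ht]; exact Nat.div_add_mod R D.L
  have hmod : R % D.L < D.L := Nat.mod_lt R hL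
  have hcomm : D.L * t = t * D.L := mul_comm _ _
  have hcommJ : D.J * D.L = D.L * D.J := mul_comm _ _
  have htJ : t ≤ D.J := by
    rw [ht]
    apply Nat.div_le_of_le_mul
    rw [htop] at hX
    omega
  have h1 : D.H + t * D.L ≤ D.H + R := by
    have := Nat.mul_div_le R D.L
    rw [← ht] at this
    omega
  have hsub : Ioc D.H (D.H + t * D.L) ⊆ Ioc D.H (D.H + R) := Ioc_subset_Ioc le_rfl h1
  have hsum : ∑ n ∈ (Ioc D.H (D.H + t * D.L)).filter (IsPQ D.P₁ D.P₂), D.seqA n ≤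
      ∑ n ∈ (Ioc D.H (D.H + R)).filter (IsPQ D.P₁ D.P₂), D.seqA n :=
    sum_le_sum_of_subset_of_nonneg (filter_subset_filter _ hsub) fun n _ _ => D.seqA_nonneg n
  have hprimes : ((Ioc D.H (D.H + R)).filter Nat.Prime).card ≤
      ((Ioc D.H (D.H + t * D.L)).filter Nat.Prime).card + D.L := by
    have hu : Ioc D.H (D.H + R) = Ioc D.H (D.H + t * D.L) ∪ Ioc (D.H + t * D.L) (D.H + R) :=
      (Ioc_union_Ioc_eq_Ioc (Nat.le_add_right _ _) h1).symm
    rw [hu, filter_union]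
    calc ((Ioc D.H (D.H + t * D.L)).filter Nat.Prime ∪
            (Ioc (D.H + t * D.L) (D.H + R)).filter Nat.Prime).card
        ≤ ((Ioc D.H (D.H + t * D.L)).filter Nat.Prime).card +
            ((Ioc (D.H + t * D.L) (D.H + R)).filter Nat.Prime).card := card_union_le _ _
      _ ≤ ((Ioc D.H (D.H + t * D.L)).filter Nat.Prime).card + D.L := by
          gcongr
          calc ((Ioc (D.H + t * D.L) (D.H + R)).filter Nat.Prime).card
              ≤ (Ioc (D.H + t * D.L) (D.H + R)).card := card_filter_le _ _
            _ = D.H + R - (D.H + t * D.L) := Nat.card_Ioc _ _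
            _ ≤ D.L := by omega
  have ih := card_primes_le_sum_seqA_isPQ D hB htJ
  have hprimes' : (((Ioc D.H (D.H + R)).filter Nat.Prime).card : ℝ) ≤
      ((Ioc D.H (D.H + t * D.L)).filter Nat.Prime).card + D.L := by exact_mod_cast hprimes
  linarith

/-! ### Ford–Maynard's Theorem 4.16 sequence, with the mass on the almost-primes recorded -/

/-- **Theorem 4.16's construction, with its support made explicit** (Type-I clause).  For
`0 < γ < α₁ < α₂ < 1/2` and `B > 0` there are `C`, `x₀` such that for every `x ≥ x₀` some sequence
`a` with `0 ≤ a ≤ C` has: `a − 1` satisfies Ford–Maynard's Type-I bound (I) at level `x^γ` with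
exponent `B`; `a_p = 0` at every prime `p ∈ (x/2, x]`; and the products `p q` (`p ≤ q` primes,
`x^{α₁} < p ≤ x^{α₂}`) of `(x/2, x]` carry total `a`-mass at least
`#primes(x/2, x] − x/(4 (log x)^B)`.  The sequence is the tree's block construction
(`FordMaynard.BlockData.seqA` with the balancing constant of `FordMaynard.exists_block_bound`);
the first two properties are proved exactly as in `FordMaynard.primeFreeAdmissible_of_window`, the
third is `card_primes_sub_le_sum_seqA_isPQ`. [folklore] -/
theorem exists_typeI_primeFree_isPQHeavy {γ α₁ α₂ B : ℝ} (hγ0 : 0 < γ) (hγα : γ < α₁)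
    (h12 : α₁ < α₂) (h2 : α₂ < 1 / 2) (hB : 0 < B) :
    ∃ C x₀ : ℝ, ∀ x : ℝ, x₀ ≤ x → ∃ a : ℕ → ℝ, (∀ n, 0 ≤ a n ∧ a n ≤ C) ∧
      TypeI (fun n => a n - 1) x γ B ∧
      (∀ p : ℕ, p.Prime → x / 2 < (p : ℝ) → (p : ℝ) ≤ x → a p = 0) ∧
      ((((Ioc ⌊x / 2⌋₊ ⌊x⌋₊).filter Nat.Prime).card : ℝ) - x / Real.log x ^ B / 4 ≤
        ∑ n ∈ (Ioc ⌊x / 2⌋₊ ⌊x⌋₊).filter (IsPQ ⌊x ^ α₁⌋₊ ⌊x ^ α₂⌋₊), a n) := by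
  have hα₁ : 0 < α₁ := hγ0.trans hγα
  obtain ⟨C₁, hC₁, hev⟩ := exists_block_bound hα₁ h12 h2 hB.le
  obtain ⟨x₀, hx₀⟩ := Filter.eventually_atTop.mp (hev.and ((eventually_ge_atTop (256 : ℝ)).and
    (eventually_mul_rpow_le_rpow 2 (by linarith : γ < 1))))
  refine ⟨1 + C₁, x₀, fun x hx => ?_⟩
  obtain ⟨⟨hL1, hblock⟩, h256, he5⟩ := hx₀ x hx
  rw [Real.rpow_one] at he5
  have hx0 : 0 < x := by linarith
  have hx1 : 1 < x := by linarith
  -- the data of the construction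
  set L : ℕ := ⌊x / Real.log x ^ B / 4⌋₊ with hLdef
  set H : ℕ := ⌊x / 2⌋₊ with hHdef
  set X : ℕ := ⌊x⌋₊ with hXdef
  set P₁ : ℕ := ⌊x ^ α₁⌋₊ with hP₁def
  set P₂ : ℕ := ⌊x ^ α₂⌋₊ with hP₂def
  set J : ℕ := (X - H + L - 1) / L with hJdef
  have hP₁ : 1 ≤ P₁ := Nat.le_floor (by rw [Nat.cast_one]; exact Real.one_le_rpow hx1.le hα₁.le)
  have hXH : H ≤ X := Nat.floor_le_floor (by linarith)
  have hJL : X ≤ H + J * L := by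
    have := Nat.lt_div_mul_add (a := X - H + L - 1) hL1
    rw [← hJdef] at this
    omega
  have hJle : J * L ≤ X - H + L - 1 := Nat.div_mul_le_self _ _
  have hlx0 : 0 < Real.log x := Real.log_pos hx1
  have hXx : (X : ℝ) ≤ x := Nat.floor_le hx0.le
  let D : BlockData := ⟨H, L, J, P₁, P₂, hL1, hP₁⟩
  have hBal : D.Balanced C₁ := by
    intro j hj
    have h1 : H + j * L ≤ X := by
      have : (j + 1) * L ≤ J * L := Nat.mul_le_mul_right L hj
      rw [Nat.succ_mul] at this
      omega
    have h2 : ((H + j * L : ℕ) : ℝ) ≤ x := le_trans (by exact_mod_cast h1) hXx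
    have h3 : x / 2 - 1 ≤ ((H + j * L : ℕ) : ℝ) := by
      have hHx : x / 2 - 1 < H := by
        have := Nat.lt_floor_add_one (x / 2); rw [← hHdef] at this; linarith
      push_cast; nlinarith
    exact hblock (H + j * L) h3 h2
  refine ⟨D.seqA, fun n => ⟨D.seqA_nonneg n, D.seqA_le hBal hC₁ n⟩, ?_, ?_, ?_⟩
  · -- (I): as in `FordMaynard.primeFreeAdmissible_of_window`
    intro I
    have hxγ1 : 1 ≤ ⌊x ^ γ⌋₊ :=
      Nat.le_floor (by rw [Nat.cast_one]; exact Real.one_le_rpow hx1.le hγ0.le)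
    rw [sum_eq_single_of_mem 1 (mem_Icc.mpr ⟨le_rfl, hxγ1⟩) ?_]
    · have hmain := D.abs_sum_one_le hBal hx0.le rfl hJL (I 1).1 (I 1).2
      have hτ : (((1 : ℕ).divisors.card : ℕ) : ℝ) ^ B = 1 := by
        rw [Nat.divisors_one, card_singleton, Nat.cast_one, Real.one_rpow]
      rw [hτ, one_mul]
      have hLr : (L : ℝ) ≤ x / Real.log x ^ B / 4 := Nat.floor_le (by positivity)
      have h0 : 0 ≤ x / Real.log x ^ B := by positivity
      refine hmain.trans ?_
      show 2 * (L : ℝ) ≤ _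
      linarith
    · intro m hm hm1
      rw [mem_Icc] at hm
      refine mul_eq_zero_of_right _ (abs_eq_zero.mpr (sum_eq_zero fun n hn => ?_))
      simp only [mem_filter, mem_Icc] at hn
      show D.seqA (m * n) - 1 = 0
      rw [sub_eq_zero]
      have hmP₁ : m ≤ P₁ :=
        hm.2.trans (Nat.floor_le_floor (Real.rpow_le_rpow_of_exponent_le hx1.le hγα.le))
      have hmx : (m : ℝ) ≤ x ^ γ := (Nat.cast_le.mpr hm.2).trans (Nat.floor_le (by positivity))
      refine D.seqA_eq_one_of_dvd hm1 ?_ (Or.inl hmP₁) ?_ (Dvd.intro n rfl)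
      · intro h
        have h' : (m : ℝ) = (m : ℝ) * n := by exact_mod_cast h
        linarith [hn.2.1]
      · intro hq h
        have h1 := hq.minFac_le_div
        have h2 := hq.1
        change P₁ < (m * n).minFac at h2
        omega
  · -- no primes
    intro p hp h1 h2
    exact D.seqA_prime hp ((Nat.floor_lt (by positivity)).mpr h1) ((Nat.le_floor h2).trans hJL)
  · -- the mass on the almost-primes
    have hmass := card_primes_sub_le_sum_seqA_isPQ D hBal hXH hJL
    have hLr : (L : ℝ) ≤ x / Real.log x ^ B / 4 := Nat.floor_le (by positivity)
    change (((Ioc H X).filter Nat.Prime).card : ℝ) - (L : ℝ) ≤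
      ∑ n ∈ (Ioc H X).filter (IsPQ P₁ P₂), D.seqA n at hmass
    linarith

end Summit.Parity.BatemanHorn.Theorems.BalancedSemiprimeLayer.Negative
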